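import Literature.Geometry.Lorentzian.PauliSpinorModel
import Literature.Geometry.Lorentzian.DivergenceTheorem
import HarnessLib

/-!
# The Sen–Witten connection and Witten's hypersurface Dirac operator in a global frame
# (Pauli model)

Vocabulary of the ANALYTIC ENGINE of Witten's proof of the positive energy theorem and of its
rigidity case (Witten 1981, §3; Parker–Taubes 1982, §3–§4; Beig–Chruściel 1996, App. A), in the
bundle-free form fixed by `TranslationalKIDsOfMassZeroReductions.lean`
(`beigChrusciel_translationalKIDs_of_admEnergy_zero_of_witten`): the data manifold `(X, h, k)`
carries a smooth global `h`-orthonormal frame `F = (F₁, F₂, F₃)`, spinor fields are maps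
`ψ : X → PauliModel.Spinor` (`ℝ⁴ ≅ ℂ²`, real inner product `Re(u†w)`, Pauli operators
`σᵢ = PauliModel.pauli i`), and

* `SenWitten.connCoeff D F i j x v = h(∇ᵥFᵢ, Fⱼ)` — the connection coefficients of the frame;
* `SenWitten.spinConnForm D F x v = −¼ Σᵢⱼ h(∇ᵥFᵢ, Fⱼ) σᵢσⱼ` — the value on `v ∈ T_xX` of the
  Riemannian spin connection form in the frame (a skew endomorphism of the spinor space), and
  `SenWitten.spinCovDeriv D F ψ x v = dψₓ(v) + spinConnForm(v) ψ(x)` — the spin covariant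
  derivative `∇ᵥψ`;
* `SenWitten.senForm D F x v = ½ Σᵢ k(v, Fᵢ) σᵢ` (a symmetric endomorphism) and
  `SenWitten.senCovDeriv D F ψ x v = ∇ᵥψ + senForm(v) ψ(x)` — the **Sen–Witten connection**
  `∇̂ᵥψ`; `SenWitten.IsParallel D F ψ` — `∇̂ψ = 0`, which is VERBATIM the parallel-spinor
  equation `dψ(v) = ¼ Σ h(∇ᵥFᵢ, Fⱼ) σᵢσⱼψ − ½ Σ k(v, Fᵢ) σᵢψ` of
  `beigChrusciel_translationalKIDs_of_admEnergy_zero_of_witten` (`senCovDeriv_eq_zero_iff`);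
* `SenWitten.dirac D F ψ x = Σᵢ σᵢ ∇_{Fᵢ}ψ` and **Witten's hypersurface Dirac operator**
  `SenWitten.wittenDirac D F ψ x = Σᵢ σᵢ ∇̂_{Fᵢ}ψ` (Witten 1981, (25); Parker–Taubes 1982, §3,
  `𝒟 = Σ eⁱ·∇̂ᵢ` up to the isometry `e⁰·`);
* `SenWitten.energyDensity D F ψ x = Σᵢ ‖∇̂_{Fᵢ}ψ‖²`, `SenWitten.current D F ψ x = Σⱼ ⟪ψ, σⱼψ⟫ Fⱼ`
  (the vector `ψ†σψ`), `SenWitten.decDensity D F ψ x = ¼ (R − |k|² + (tr k)²) ‖ψ‖² +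
  ½ (div k − d tr k)(current)` — the zeroth-order term of the Lichnerowicz–Witten identity
  (`= 4π(μ‖ψ‖² + ⟪ψ, J·σ ψ⟫)`, Parker–Taubes 1982, (3.1)–(3.2)), and
  `SenWitten.wittenFlux D F ψ x = Σᵢ (⟪σᵢψ, 𝒟ψ⟫ − ⟪ψ, ∇̂_{Fᵢ}ψ⟫) Fᵢ` — the vector field whose
  divergence is `‖𝒟ψ‖² − Σᵢ‖∇̂ᵢψ‖² − decDensity` and whose flux through large coordinate spheres
  is `4π(E‖ψ₀‖² + ⟪ψ₀, P·σψ₀⟫)` (Parker–Taubes 1982, (4.1)–(4.3)).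

Proved here (pointwise algebra only): skewness of `spinConnForm`, symmetry of `senForm`,
`‖(Σ aⱼσⱼ)u‖² = (Σ aⱼ²)‖u‖²`, the bridge `senCovDeriv_eq_zero_iff`, the decomposition
`wittenDirac = dirac + ½ (Σᵢ k(Fᵢ,Fᵢ)) ψ`, and the compatibility identities
`v⟪ψ, φ⟫ = ⟪∇ᵥψ, φ⟫ + ⟪ψ, ∇ᵥφ⟫`, `⟪∇̂ᵥψ, φ⟫ + ⟪ψ, ∇̂ᵥφ⟫ = v⟪ψ, φ⟫ + k(v, Σ⟪ψ,σᵢφ⟫Fᵢ)`.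
Definitions are concrete; no named facts.

## References

* E. Witten, *A new proof of the positive energy theorem*, Comm. Math. Phys. 80 (1981) 381–402,
  §3, (23)–(34). [Witten1981]
* T. Parker, C. H. Taubes, *On Witten's proof of the positive energy theorem*, Comm. Math. Phys.
  84 (1982) 223–238, §3 (Weitzenböck formula (3.1)–(3.2)), §4 ((4.1)–(4.3), Lemma 4.3).
  [ParkerTaubes1982]
* R. Beig, P. T. Chruściel, *Killing vectors in asymptotically flat space-times. I*, J. Math.
  Phys. 37 (1996) 1939–1961, App. A, (A.7)–(A.10). [BeigChrusciel1996]
-/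

noncomputable section

open Bundle Set Function Manifold Finset Filter
open scoped Manifold ContDiff Topology RealInnerProductSpace

namespace Literature.Geometry.Lorentzian

namespace SenWitten

open PauliModel

variable {X : Type*} [TopologicalSpace X] [ChartedSpace E3 X] [IsManifold (𝓡 3) ∞ X]
  (D : InitialDataSet (𝓡 3) X) (F : Fin 3 → Π x : X, TangentSpace (𝓡 3) x)

/-! ### Pointwise Clifford algebra in the Pauli model -/

/-- `σᵢ² = 1`. [folklore] -/
theorem pauli_sq (i : Fin 3) (a : Spinor) : pauli i (pauli i a) = a := by
  have h := pauli_clifford i i a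
  rw [if_pos rfl, ← two_smul ℝ] at h
  exact smul_right_injective Spinor two_ne_zero h

/-- `σⱼσᵢ = −σᵢσⱼ` for `i ≠ j`. [folklore] -/
theorem pauli_anticomm {i j : Fin 3} (hij : i ≠ j) (a : Spinor) :
    pauli j (pauli i a) = -pauli i (pauli j a) := by
  have h := pauli_clifford i j a
  rw [if_neg hij] at h
  exact eq_neg_of_add_eq_zero_right h

/-- `σᵢσⱼ` is skew for `i ≠ j`: `⟪σᵢσⱼa, b⟫ = −⟪a, σᵢσⱼb⟫`. [folklore] -/
theorem inner_pauli_pauli_of_ne {i j : Fin 3} (hij : i ≠ j) (a b : Spinor) :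
    ⟪pauli i (pauli j a), b⟫ = -⟪a, pauli i (pauli j b)⟫ := by
  rw [pauli_symm, pauli_symm, pauli_anticomm hij, inner_neg_right]

/-- `⟪a, σᵢσⱼa⟫ = 0` for `i ≠ j`. [folklore] -/
theorem inner_self_pauli_pauli_of_ne {i j : Fin 3} (hij : i ≠ j) (a : Spinor) :
    ⟪a, pauli i (pauli j a)⟫ = 0 := by
  have h := inner_pauli_pauli_of_ne hij a a
  rw [real_inner_comm] at h
  linarith

/-- **`‖(Σⱼ aⱼσⱼ) u‖² = (Σⱼ aⱼ²) ‖u‖²`**: a Clifford vector acts as `|a|` times an isometry.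
[folklore] -/
theorem norm_sq_sum_smul_pauli (a : Fin 3 → ℝ) (u : Spinor) :
    ‖∑ j, a j • pauli j u‖ ^ 2 = (∑ j, a j ^ 2) * ‖u‖ ^ 2 := by
  have h01 := inner_self_pauli_pauli_of_ne (show (0 : Fin 3) ≠ 1 by decide) u
  have h02 := inner_self_pauli_pauli_of_ne (show (0 : Fin 3) ≠ 2 by decide) u
  have h12 := inner_self_pauli_pauli_of_ne (show (1 : Fin 3) ≠ 2 by decide) u
  have h10 : ⟪u, pauli 1 (pauli 0 u)⟫ = 0 := by
    rw [pauli_anticomm (show (0 : Fin 3) ≠ 1 by decide), inner_neg_right, h01, neg_zero]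
  have h20 : ⟪u, pauli 2 (pauli 0 u)⟫ = 0 := by
    rw [pauli_anticomm (show (0 : Fin 3) ≠ 2 by decide), inner_neg_right, h02, neg_zero]
  have h21 : ⟪u, pauli 2 (pauli 1 u)⟫ = 0 := by
    rw [pauli_anticomm (show (1 : Fin 3) ≠ 2 by decide), inner_neg_right, h12, neg_zero]
  have hsq : ∀ i, ⟪pauli i u, pauli i u⟫ = ‖u‖ ^ 2 := fun i ↦ by
    rw [pauli_symm, pauli_sq, real_inner_self_eq_norm_sq]
  have hcross : ∀ i j, ⟪pauli i u, pauli j u⟫ = ⟪u, pauli i (pauli j u)⟫ := fun i j ↦ by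
    rw [pauli_symm]
  rw [← real_inner_self_eq_norm_sq]
  simp only [Fin.sum_univ_three, inner_add_left, inner_add_right, inner_smul_left,
    inner_smul_right, RCLike.conj_to_real, hsq, hcross, h01, h02, h12, h10, h20, h21]
  ring

/-! ### The connection forms -/

/-- The **connection coefficients of the frame**: `ω_{ij}(v) = h(∇ᵥFᵢ, Fⱼ)` at `x`, for the
Levi-Civita connection of `h` (Mathlib argument order `∇ Y x v = ∇ᵥY`). For an orthonormal frame
`ω_{ij} = −ω_{ji}` (`SenParallel.val_leviCivita_frame_antisymm`). O'Neill 1983, Ch. 3,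
Prop. 3.13; Parker–Taubes 1982, §3. [cite: ParkerTaubes1982, §3] -/
def connCoeff [D.metric.HasLeviCivita] (i j : Fin 3) (x : X) (v : TangentSpace (𝓡 3) x) : ℝ :=
  D.metric.val x (D.metric.leviCivita (F i) x v) (F j x)

/-- The **Riemannian spin connection form in the frame**: the endomorphism
`A(v) = −¼ Σᵢⱼ ω_{ij}(v) σᵢσⱼ` of the spinor space (Clifford multiplication by `Fᵢ` being
`iσᵢ`, `¼ Σ ω_{ij} eᵢ·eⱼ· = −¼ Σ ω_{ij} σᵢσⱼ`), so that `∇ᵥψ = dψ(v) + A(v)ψ`.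
Lawson–Michelsohn, *Spin Geometry*, Thm. II.4.14; Parker–Taubes 1982, §3; Beig–Chruściel 1996,
(A.7). [cite: ParkerTaubes1982, §3] -/
def spinConnForm [D.metric.HasLeviCivita] (x : X) (v : TangentSpace (𝓡 3) x) :
    Spinor →L[ℝ] Spinor :=
  -((1 / 4 : ℝ) • ∑ i, ∑ j, connCoeff D F i j x v • (pauli i).comp (pauli j))

/-- The **second-fundamental-form term of the Sen–Witten connection**: the symmetric endomorphism
`K(v) = ½ Σᵢ k(v, Fᵢ) σᵢ` (Clifford multiplication by `½ k(v)·e₀`). Witten 1981, (24);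
Parker–Taubes 1982, §3; Beig–Chruściel 1996, (A.8). [cite: Witten1981, §3, (24)] -/
def senForm (x : X) (v : TangentSpace (𝓡 3) x) : Spinor →L[ℝ] Spinor :=
  (1 / 2 : ℝ) • ∑ i, D.k x v (F i x) • pauli i

/-- The **spin covariant derivative** of a spinor field in the frame:
`∇ᵥψ = dψₓ(v) − ¼ Σᵢⱼ h(∇ᵥFᵢ, Fⱼ) σᵢσⱼ ψ(x)`. Parker–Taubes 1982, §3. [cite: ParkerTaubes1982, §3] -/
def spinCovDeriv [D.metric.HasLeviCivita] (ψ : X → Spinor) (x : X) (v : TangentSpace (𝓡 3) x) :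
    Spinor :=
  mvfderiv (𝓡 3) ψ x v + spinConnForm D F x v (ψ x)

/-- The **Sen–Witten covariant derivative** of a spinor field in the frame:
`∇̂ᵥψ = ∇ᵥψ + ½ Σᵢ k(v, Fᵢ) σᵢ ψ` — the restriction to the hypersurface of the space-time spin
connection. Witten 1981, (24); Parker–Taubes 1982, §3 (`∇̂`); Beig–Chruściel 1996, (A.8).
[cite: Witten1981, §3, (24)] -/
def senCovDeriv [D.metric.HasLeviCivita] (ψ : X → Spinor) (x : X) (v : TangentSpace (𝓡 3) x) :
    Spinor :=
  spinCovDeriv D F ψ x v + senForm D F x v (ψ x)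

/-- A spinor field is **Sen–Witten parallel**: `∇̂ψ = 0` identically. By
`senCovDeriv_eq_zero_iff` this is verbatim the equation
`dψ(v) = ¼ Σ h(∇ᵥFᵢ, Fⱼ) σᵢσⱼψ − ½ Σ k(v, Fᵢ) σᵢψ` of
`beigChrusciel_translationalKIDs_of_admEnergy_zero_of_witten`. Witten 1981, §3 (after (34));
Beig–Chruściel 1996, (A.10). [cite: BeigChrusciel1996, App. A, (A.10)] -/
def IsParallel [D.metric.HasLeviCivita] (ψ : X → Spinor) : Prop :=
  ∀ (x : X) (v : TangentSpace (𝓡 3) x), senCovDeriv D F ψ x v = 0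

/-- The **Riemannian Dirac operator in the frame**: `D̸ψ = Σᵢ σᵢ ∇_{Fᵢ}ψ` (the geometric
Dirac operator `Σ eᵢ·∇ᵢ` up to the complex structure, `eᵢ· = iσᵢ`). Lawson–Michelsohn,
*Spin Geometry*, II §5; Parker–Taubes 1982, §3. [cite: ParkerTaubes1982, §3] -/
def dirac [D.metric.HasLeviCivita] (ψ : X → Spinor) (x : X) : Spinor :=
  ∑ i, pauli i (spinCovDeriv D F ψ x (F i x))

/-- **Witten's hypersurface Dirac operator** in the frame: `𝒟ψ = Σᵢ σᵢ ∇̂_{Fᵢ}ψ`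
(Parker–Taubes' `Σ eⁱ·∇̂ᵢ` composed with the isometry `e⁰·`, which changes neither `‖𝒟ψ‖` nor
the kernel). Witten 1981, (25); Parker–Taubes 1982, §3. [cite: Witten1981, §3, (25)] -/
def wittenDirac [D.metric.HasLeviCivita] (ψ : X → Spinor) (x : X) : Spinor :=
  ∑ i, pauli i (senCovDeriv D F ψ x (F i x))

/-- The **Sen–Witten energy density** `Σᵢ ‖∇̂_{Fᵢ}ψ‖²` (`= |∇̂ψ|²_h` in the orthonormal frame),
the integrand of Witten's mass formula. Witten 1981, (33); Parker–Taubes 1982, (3.2), (4.1).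
[cite: ParkerTaubes1982, (4.1)] -/
def energyDensity [D.metric.HasLeviCivita] (ψ : X → Spinor) (x : X) : ℝ :=
  ∑ i, ‖senCovDeriv D F ψ x (F i x)‖ ^ 2

/-- The **current of a spinor field**: the vector `Y = Σⱼ ⟪ψ, σⱼψ⟫ Fⱼ` (`Yⱼ = ψ†σⱼψ`; for a
parallel `ψ` the shift of the timelike translational KID, Beig–Chruściel 1996, (A.11.0)).
[cite: BeigChrusciel1996, App. A, (A.11.0)] -/
def current (ψ : X → Spinor) (x : X) : TangentSpace (𝓡 3) x :=
  ∑ j, ⟪ψ x, pauli j (ψ x)⟫ • F j x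

/-- The **dominant-energy density of a spinor field**: the zeroth-order term
`¼ (R(h) − |k|² + (tr k)²) ‖ψ‖² + ½ (div k − d tr k)(Y_ψ) = 4π (μ ‖ψ‖² + ⟪ψ, Σⱼ J(Fⱼ) σⱼ ψ⟫)`
of the Lichnerowicz–Witten identity (`hamiltonianConstraintFn = 16πμ`,
`momentumConstraintFn = 8πJ`); non-negative under the dominant energy condition `|J| ≤ μ`.
Witten 1981, (34); Parker–Taubes 1982, (3.1)–(3.2) (`ℛ = ¼(R + 2R₀₀ + 2R₀ᵢe⁰eⁱ)`).
[cite: ParkerTaubes1982, (3.1)–(3.2)] -/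
def decDensity [D.metric.HasLeviCivita] (ψ : X → Spinor) (x : X) : ℝ :=
  (1 / 4 : ℝ) * D.hamiltonianConstraintFn x * ‖ψ x‖ ^ 2 +
    (1 / 2 : ℝ) * D.momentumConstraintFn x (current F ψ x)

/-- **Witten's flux vector field**: `B = Σᵢ (⟪σᵢψ, 𝒟ψ⟫ − ⟪ψ, ∇̂_{Fᵢ}ψ⟫) Fᵢ`
(`= Σᵢ Σ_{j≠i} ⟪ψ, σᵢσⱼ ∇̂ⱼψ⟫ Fᵢ`), whose divergence is
`‖𝒟ψ‖² − Σᵢ ‖∇̂ᵢψ‖² − decDensity ψ` and whose outward flux through the coordinate spheres of an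
asymptotically flat end tends, for `ψ → ψ₀`, to `4π (E ‖ψ₀‖² + ⟪ψ₀, Σⱼ Pⱼσⱼψ₀⟫)`.
Witten 1981, (30)–(33); Parker–Taubes 1982, (3.2) and (4.2)–(4.3) (the 2-form `η`).
[cite: ParkerTaubes1982, (4.2)–(4.3)] -/
def wittenFlux [D.metric.HasLeviCivita] (ψ : X → Spinor) (x : X) : TangentSpace (𝓡 3) x :=
  ∑ i, (⟪pauli i (ψ x), wittenDirac D F ψ x⟫ - ⟪ψ x, senCovDeriv D F ψ x (F i x)⟫) • F i x

/-! ### Unfolding lemmas -/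

section Unfold

variable [D.metric.HasLeviCivita]

/-- Unfolding of `connCoeff`. [folklore] -/
theorem connCoeff_apply (i j : Fin 3) (x : X) (v : TangentSpace (𝓡 3) x) :
    connCoeff D F i j x v = D.metric.val x (D.metric.leviCivita (F i) x v) (F j x) := rfl

/-- Unfolding of `spinConnForm` on a spinor. [folklore] -/
theorem spinConnForm_apply (x : X) (v : TangentSpace (𝓡 3) x) (u : Spinor) :
    spinConnForm D F x v u = -((1 / 4 : ℝ) • ∑ i, ∑ j, connCoeff D F i j x v • pauli i (pauli j u)) := by
  simp [spinConnForm, Finset.smul_sum]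

omit [D.metric.HasLeviCivita] in
/-- Unfolding of `senForm` on a spinor. [folklore] -/
theorem senForm_apply (x : X) (v : TangentSpace (𝓡 3) x) (u : Spinor) :
    senForm D F x v u = (1 / 2 : ℝ) • ∑ i, D.k x v (F i x) • pauli i u := by
  simp [senForm, Finset.smul_sum]

/-- Unfolding of `spinCovDeriv`. [folklore] -/
theorem spinCovDeriv_apply (ψ : X → Spinor) (x : X) (v : TangentSpace (𝓡 3) x) :
    spinCovDeriv D F ψ x v = mvfderiv (𝓡 3) ψ x v + spinConnForm D F x v (ψ x) := rfl

/-- Unfolding of `senCovDeriv`. [folklore] -/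
theorem senCovDeriv_apply (ψ : X → Spinor) (x : X) (v : TangentSpace (𝓡 3) x) :
    senCovDeriv D F ψ x v =
      mvfderiv (𝓡 3) ψ x v + spinConnForm D F x v (ψ x) + senForm D F x v (ψ x) := rfl

/-- Unfolding of `dirac`. [folklore] -/
theorem dirac_apply (ψ : X → Spinor) (x : X) :
    dirac D F ψ x = ∑ i, pauli i (spinCovDeriv D F ψ x (F i x)) := rfl

/-- Unfolding of `wittenDirac`. [folklore] -/
theorem wittenDirac_apply (ψ : X → Spinor) (x : X) :
    wittenDirac D F ψ x = ∑ i, pauli i (senCovDeriv D F ψ x (F i x)) := rfl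

/-- Unfolding of `energyDensity`. [folklore] -/
theorem energyDensity_apply (ψ : X → Spinor) (x : X) :
    energyDensity D F ψ x = ∑ i, ‖senCovDeriv D F ψ x (F i x)‖ ^ 2 := rfl

omit [IsManifold (𝓡 3) ∞ X] [D.metric.HasLeviCivita] in
/-- Unfolding of `current`. [folklore] -/
theorem current_apply (ψ : X → Spinor) (x : X) :
    current F ψ x = ∑ j, ⟪ψ x, pauli j (ψ x)⟫ • F j x := rfl

/-- Unfolding of `decDensity`. [folklore] -/
theorem decDensity_apply (ψ : X → Spinor) (x : X) :
    decDensity D F ψ x = (1 / 4 : ℝ) * D.hamiltonianConstraintFn x * ‖ψ x‖ ^ 2 +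
      (1 / 2 : ℝ) * D.momentumConstraintFn x (current F ψ x) := rfl

/-- Unfolding of `wittenFlux`. [folklore] -/
theorem wittenFlux_apply (ψ : X → Spinor) (x : X) :
    wittenFlux D F ψ x =
      ∑ i, (⟪pauli i (ψ x), wittenDirac D F ψ x⟫ - ⟪ψ x, senCovDeriv D F ψ x (F i x)⟫) • F i x :=
  rfl

/-- The energy density is non-negative. [folklore] -/
theorem energyDensity_nonneg (ψ : X → Spinor) (x : X) : 0 ≤ energyDensity D F ψ x :=
  Finset.sum_nonneg fun _ _ ↦ by positivity

/-- **Bridge to the equation of `beigChrusciel_translationalKIDs_of_admEnergy_zero_of_witten`**: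
`∇̂ᵥψ = 0` iff `dψ(v) = ¼ Σᵢⱼ h(∇ᵥFᵢ, Fⱼ) σᵢσⱼψ − ½ Σᵢ k(v, Fᵢ) σᵢψ`.
[cite: BeigChrusciel1996, App. A, (A.10)] -/
theorem senCovDeriv_eq_zero_iff (ψ : X → Spinor) (x : X) (v : TangentSpace (𝓡 3) x) :
    senCovDeriv D F ψ x v = 0 ↔
      mvfderiv (𝓡 3) ψ x v =
        (1 / 4 : ℝ) • (∑ i, ∑ j,
          D.metric.val x (D.metric.leviCivita (F i) x v) (F j x) • pauli i (pauli j (ψ x))) -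
          (1 / 2 : ℝ) • ∑ i, D.k x v (F i x) • pauli i (ψ x) := by
  rw [senCovDeriv_apply, spinConnForm_apply, senForm_apply]
  simp only [connCoeff_apply]
  constructor
  · intro h
    rw [← sub_eq_zero, ← h]
    abel
  · intro h
    rw [h]
    abel

/-- `IsParallel` unfolded to the equation of
`beigChrusciel_translationalKIDs_of_admEnergy_zero_of_witten`. [cite: BeigChrusciel1996, App. A, (A.10)] -/
theorem isParallel_iff (ψ : X → Spinor) :
    IsParallel D F ψ ↔ ∀ (x : X) (v : TangentSpace (𝓡 3) x),
      mvfderiv (𝓡 3) ψ x v =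
        (1 / 4 : ℝ) • (∑ i, ∑ j,
          D.metric.val x (D.metric.leviCivita (F i) x v) (F j x) • pauli i (pauli j (ψ x))) -
          (1 / 2 : ℝ) • ∑ i, D.k x v (F i x) • pauli i (ψ x) :=
  forall₂_congr fun x v ↦ senCovDeriv_eq_zero_iff D F ψ x v

/-- For a parallel spinor field the energy density vanishes. [folklore] -/
theorem IsParallel.energyDensity_eq_zero {ψ : X → Spinor} (h : IsParallel D F ψ) (x : X) :
    energyDensity D F ψ x = 0 := by
  simp [energyDensity_apply, h x]

/-- For a parallel spinor field `𝒟ψ = 0`. [folklore] -/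
theorem IsParallel.wittenDirac_eq_zero {ψ : X → Spinor} (h : IsParallel D F ψ) (x : X) :
    wittenDirac D F ψ x = 0 := by
  simp [wittenDirac_apply, h x]

end Unfold

/-! ### Symmetry of the connection forms -/

section Symmetry

variable [D.metric.HasLeviCivita]

omit [D.metric.HasLeviCivita] in
/-- **`K(v)` is symmetric**: `⟪K(v)a, b⟫ = ⟪a, K(v)b⟫` (the Pauli operators are symmetric).
Parker–Taubes 1982, §3 (`e⁰eʲ·` is Hermitian). [cite: ParkerTaubes1982, §3] -/
theorem inner_senForm_left (x : X) (v : TangentSpace (𝓡 3) x) (a b : Spinor) :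
    ⟪senForm D F x v a, b⟫ = ⟪a, senForm D F x v b⟫ := by
  simp only [senForm_apply, inner_smul_left, inner_smul_right, sum_inner, inner_sum,
    RCLike.conj_to_real, pauli_symm]

/-- **`A(v)` is skew** for an orthonormal frame: `⟪A(v)a, b⟫ = −⟪a, A(v)b⟫` (`ω_{ij} = −ω_{ji}`
and `σᵢσⱼ` is skew for `i ≠ j`), i.e. the spin connection is metric. Parker–Taubes 1982, §3.
[cite: ParkerTaubes1982, §3] -/
theorem inner_spinConnForm_left
    (hF : ∀ i x, MDifferentiableAt (𝓡 3) ((𝓡 3).prod 𝓘(ℝ, E3))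
      (fun y ↦ (TotalSpace.mk' E3 y (F i y) : TangentBundle (𝓡 3) X)) x)
    (horth : ∀ x i j, D.h.inner x (F i x) (F j x) = if i = j then 1 else 0)
    (x : X) (v : TangentSpace (𝓡 3) x) (a b : Spinor) :
    ⟪spinConnForm D F x v a, b⟫ = -⟪a, spinConnForm D F x v b⟫ := by
  have hanti : ∀ i j, connCoeff D F i j x v = -connCoeff D F j i x v := fun i j ↦
    SenParallel.val_leviCivita_frame_antisymm D hF horth x v i j
  have hdiag : ∀ i, connCoeff D F i i x v = 0 := fun i ↦ by linarith [hanti i i]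
  have h10 := hanti 1 0
  have h20 := hanti 2 0
  have h21 := hanti 2 1
  have ha01 := pauli_anticomm (show (0 : Fin 3) ≠ 1 by decide)
  have ha02 := pauli_anticomm (show (0 : Fin 3) ≠ 2 by decide)
  have ha12 := pauli_anticomm (show (1 : Fin 3) ≠ 2 by decide)
  have hi01 := inner_pauli_pauli_of_ne (show (0 : Fin 3) ≠ 1 by decide)
  have hi02 := inner_pauli_pauli_of_ne (show (0 : Fin 3) ≠ 2 by decide)
  have hi12 := inner_pauli_pauli_of_ne (show (1 : Fin 3) ≠ 2 by decide)
  simp only [spinConnForm_apply, inner_neg_left, inner_neg_right, inner_smul_left,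
    inner_smul_right, inner_add_left, inner_add_right, RCLike.conj_to_real, Fin.sum_univ_three,
    hdiag, h10, h20, h21, zero_smul, zero_add, add_zero, ha01, ha02, ha12, smul_neg, neg_smul,
    neg_neg, hi01, hi02, hi12]
  ring

end Symmetry

/-! ### Decomposition of Witten's operator -/

section Decomposition

variable [D.metric.HasLeviCivita]

/-- **`𝒟ψ = D̸ψ + ½ (Σᵢ k(Fᵢ, Fᵢ)) ψ`**: the Sen–Witten term contributes the multiplication by
half the mean curvature (`Σᵢⱼ k_{ij} σᵢσⱼ = tr k` by symmetry of `k` and the Clifford relations).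
Witten 1981, (25)–(26); Parker–Taubes 1982, §3 (`𝒟 = D̸ − ½ (tr k) e⁰·`).
[cite: ParkerTaubes1982, §3] -/
theorem wittenDirac_eq_dirac_add (ψ : X → Spinor) (x : X) :
    wittenDirac D F ψ x = dirac D F ψ x + ((1 / 2 : ℝ) * ∑ i, D.k x (F i x) (F i x)) • ψ x := by
  have hks : ∀ i j, D.k x (F i x) (F j x) = D.k x (F j x) (F i x) := fun i j ↦ D.k_symm x _ _
  have h10 := hks 1 0
  have h20 := hks 2 0
  have h21 := hks 2 1
  have hsq := pauli_sq
  have ha01 := pauli_anticomm (show (0 : Fin 3) ≠ 1 by decide)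
  have ha02 := pauli_anticomm (show (0 : Fin 3) ≠ 2 by decide)
  have ha12 := pauli_anticomm (show (1 : Fin 3) ≠ 2 by decide)
  simp only [wittenDirac_apply, dirac_apply, senCovDeriv, senForm_apply, map_add, map_smul,
    Fin.sum_univ_three, hsq, h10, h20, h21, ha01, ha02, ha12, smul_neg]
  module

end Decomposition

/-! ### Compatibility of the connections with the inner product -/

section Compatibility

variable [D.metric.HasLeviCivita]

/-- **The spin connection is metric**: `d⟪ψ, φ⟫(v) = ⟪∇ᵥψ, φ⟫ + ⟪ψ, ∇ᵥφ⟫` for spinor fields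
differentiable at `x` and an orthonormal frame. Parker–Taubes 1982, §3; Lawson–Michelsohn,
Prop. II.4.11. [cite: ParkerTaubes1982, §3] -/
theorem mvfderiv_inner_eq_spinCovDeriv
    (hF : ∀ i x, MDifferentiableAt (𝓡 3) ((𝓡 3).prod 𝓘(ℝ, E3))
      (fun y ↦ (TotalSpace.mk' E3 y (F i y) : TangentBundle (𝓡 3) X)) x)
    (horth : ∀ x i j, D.h.inner x (F i x) (F j x) = if i = j then 1 else 0)
    {ψ φ : X → Spinor} {x : X} (hψ : MDifferentiableAt (𝓡 3) 𝓘(ℝ, Spinor) ψ x)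
    (hφ : MDifferentiableAt (𝓡 3) 𝓘(ℝ, Spinor) φ x)
    (v : TangentSpace (𝓡 3) x) :
    mvfderiv (𝓡 3) (fun y ↦ ⟪ψ y, φ y⟫) x v =
      ⟪spinCovDeriv D F ψ x v, φ x⟫ + ⟪ψ x, spinCovDeriv D F φ x v⟫ := by
  rw [SenParallel.mvfderiv_real_inner hψ hφ, spinCovDeriv_apply, spinCovDeriv_apply,
    inner_add_left, inner_add_right, inner_spinConnForm_left D F hF horth]
  ring

/-- **The Sen–Witten connection is not metric, with an explicit defect**:
`⟪∇̂ᵥψ, φ⟫ + ⟪ψ, ∇̂ᵥφ⟫ = d⟪ψ, φ⟫(v) + k(v, Σᵢ ⟪ψ, σᵢφ⟫ Fᵢ)` — for `φ = ψ`: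
`d‖ψ‖²(v) = 2⟪∇̂ᵥψ, ψ⟫ − k(v, Y_ψ)`, the identity behind Parker–Taubes' Lemma 4.3.
[cite: ParkerTaubes1982, Lemma 4.3] -/
theorem inner_senCovDeriv_add_inner_senCovDeriv
    (hF : ∀ i x, MDifferentiableAt (𝓡 3) ((𝓡 3).prod 𝓘(ℝ, E3))
      (fun y ↦ (TotalSpace.mk' E3 y (F i y) : TangentBundle (𝓡 3) X)) x)
    (horth : ∀ x i j, D.h.inner x (F i x) (F j x) = if i = j then 1 else 0)
    {ψ φ : X → Spinor} {x : X} (hψ : MDifferentiableAt (𝓡 3) 𝓘(ℝ, Spinor) ψ x)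
    (hφ : MDifferentiableAt (𝓡 3) 𝓘(ℝ, Spinor) φ x)
    (v : TangentSpace (𝓡 3) x) :
    ⟪senCovDeriv D F ψ x v, φ x⟫ + ⟪ψ x, senCovDeriv D F φ x v⟫ =
      mvfderiv (𝓡 3) (fun y ↦ ⟪ψ y, φ y⟫) x v +
        D.k x v (∑ i, ⟪ψ x, pauli i (φ x)⟫ • F i x) := by
  rw [mvfderiv_inner_eq_spinCovDeriv D F hF horth hψ hφ]
  simp only [senCovDeriv, inner_add_left, inner_add_right, map_add, map_smul, smul_eq_mul,
    senForm_apply, inner_smul_right, inner_smul_left, pauli_symm, RCLike.conj_to_real,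
    Fin.sum_univ_three]
  ring

/-- **Derivative of `‖ψ‖²` along the Sen–Witten connection**:
`d‖ψ‖²(v) = 2⟪∇̂ᵥψ, ψ⟫ − k(v, Y_ψ)` with the current `Y_ψ = Σ ⟪ψ, σᵢψ⟫ Fᵢ`; for a parallel
`ψ` this is the lapse equation `dN = −k(·, Y)`. Parker–Taubes 1982, proof of Lemma 4.3;
Beig–Chruściel 1996, (A.11). [cite: ParkerTaubes1982, Lemma 4.3] -/
theorem mvfderiv_norm_sq
    (hF : ∀ i x, MDifferentiableAt (𝓡 3) ((𝓡 3).prod 𝓘(ℝ, E3))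
      (fun y ↦ (TotalSpace.mk' E3 y (F i y) : TangentBundle (𝓡 3) X)) x)
    (horth : ∀ x i j, D.h.inner x (F i x) (F j x) = if i = j then 1 else 0)
    {ψ : X → Spinor} {x : X} (hψ : MDifferentiableAt (𝓡 3) 𝓘(ℝ, Spinor) ψ x)
    (v : TangentSpace (𝓡 3) x) :
    mvfderiv (𝓡 3) (fun y ↦ ‖ψ y‖ ^ 2) x v =
      2 * ⟪senCovDeriv D F ψ x v, ψ x⟫ - D.k x v (current F ψ x) := by
  have h := inner_senCovDeriv_add_inner_senCovDeriv D F hF horth hψ hψ v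
  have hfun : (fun y ↦ ‖ψ y‖ ^ 2) = fun y ↦ ⟪ψ y, ψ y⟫ :=
    funext fun y ↦ (real_inner_self_eq_norm_sq (ψ y)).symm
  rw [hfun, current_apply]
  rw [← real_inner_comm (ψ x) (senCovDeriv D F ψ x v)] at h
  linarith

end Compatibility

end SenWitten

end Literature.Geometry.Lorentzian

end
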